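import Summits.QuantumFields.YangMills.Theorems.BalabanUVNodesK2NamedJetsLimit

/-!
# Crux K2⁷ `EndpointGivenBR13SepCoPH` (stmt-QuantumFields-20543) — NAMED JETS AND THE CORNER-DRIFT STUB 2ᶜᴰ `CornerDriftPos` OF SKELETON v7 (corner re-key of (β3)):
# the VALUE-keyed use forms «anchor at a colour datum + (D1) at print's table ⟹ 2ᶜᴰ» (the planner's WANTED wording), their pinned edition, and the honest converse — at a tuple
# whose record is ANCHORED by the scaled named numbers, 2ᶜᴰ's body IS the SIGN of ONE real number `CauchyRate.lim (beta0OfJs F κ)` (slope uniqueness + anchor uniqueness)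

Cell `ym-nodeO-ideate`, seat `ym-nodeO-d1-w2` (gen 2; explicit unit; director-ym R399 (3a) ∕ №206).  `--kind proof --supports stmt-QuantumFields-20543 --as helper`; count-neutral.
ASKED FOR by the planner of record: plan g84 `[YMPLAN-G84-K2V7-WINDOW-OUTCOME + CORNER RE-KEY DRAFT 39189bf31904f7f3]` «★ D1-W2 g2 (use form: WANTED after registration, in corner
currency — «anchor at an on-variety κ `ScaleAnchor D.βfun (θ.cβ • beta0OfJs F κ)` + (D1) at print's table + `0 < θ.cβ·stepBal 2 F.L` ⟹ 2ᶜᴰ» by ∃-intro, `oneLoopDrift_const_mul`)».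
The v7 corner re-key (plan g84 on CRIT-2 g3's price (P2) of the fill-keyed precut): LINE 1′ = {2ᶜᴰ `stub_cornerDriftPos13 : CornerDriftPos`, 1ᶜᴿ `stub_runChainCornerSlope13 :
RunChain190AtCornerDriftSlope`}; 2ᶜᴰ's text is reproduced INLINE below (v7c draft :535 VERBATIM over the tree letters `K2V6Defs.Window13`, `K2NamedJetsRemAt.ScaleAnchor`,
`Beta.Drift.OneLoopDrift`); DEF-1's by-name mirror (`…K2V7Defs.cornerDriftPos_iff_inline`, INTENT-8) converts every conclusion here to the registered NAME.
SPLIT WITH SEAT `ym-nodeO-d1-w1` (gen 2, CLAIM-2 `…K2CornerDriftOfAnchorSign`, by lineage): the hypothesis-free «named numbers ALWAYS drift at their own limit» (`drift_beta0OfJs_at_lim`),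
the SIGN-keyed road from that seat's gen-0 letter Anchor-Positiveᴷ, and the projections «v6's registered pair ⟹ 2ᶜᴰ» ∕ «LINE 1″ ⟹ 2ᶜᴰ» are THAT seat's file; here the always-drift
enters only through a PRIVATE twin (same 3-line proof; public name theirs), exactly as that seat's p610944 carried a private twin of this lineage's `lim_beta0OfJs_normalForm`.

WHAT IS HERE (0 `def`; [folklore] bookkeeping BY NAME over tree theorems — gan24-p1's all-scales rate `GAN24.WSlotT2TablesAn1.allScalesSeq_secondMoment_JsBalAn1_pinned`, the β
sub-cell's `RateCertificate` (`CauchyRate.lim_eq_of_drift`, `CauchyRate.geomRate`, `GeomRate.drift`), DEF-1's `ScaleAnchor` ∕ `K2V6Defs.Window13`, seat d1-w1's `…K2NamedJetsLimit`,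
CRIT-1's `oneLoopDrift_const_mul`):
* §1 SLOPE UNIQUENESS for the named numbers: `lim_eq_of_drift_slope` (a drift of `beta0OfJs F κ` at ANY real slope `s` forces `CauchyRate.lim (beta0OfJs F κ) = s` — d1-w1's
  `drift_iff_lim_eq` (→) freed from `stepBal N`), `slope_eq_of_drift_smul` (a drift of `c • beta0OfJs F κ`, `c ≠ 0`, at `s` forces `s = c · lim`), `exists_posDrift_smul_iff_lim_pos`
  (`0 < c`: a positive drift of `c • beta0OfJs F κ` ⟺ `0 < lim`).
* §2 PER TUPLE, at an ADMISSIBLE tuple whose record's β is anchored scale by scale by `θ.cβ • beta0OfJs F κ`: `eq_of_namedAnchor_cornerDrift` (ANY anchoring `b` drifting at `s` IS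
  `θ.cβ • beta0OfJs F κ`, and `s = θ.cβ · lim` — `ScaleAnchor.eq` + §1); ★★ `cornerDriftAt_iff_limPos_of_namedAnchor` (2ᶜᴰ's body `∃ b s A, ScaleAnchor D.βfun b ∧ 0 < s ∧ OneLoopDrift s A b`
  ⟺ `0 < CauchyRate.lim (beta0OfJs F κ)`; the (←) half is d1-w1's sign road read at one tuple); `cornerDriftAt_of_namedAnchor_drift` ((D1) at print's table ⟹ the body with Bałaban's
  scaled slope `θ.cβ · stepBal 2 F.L` explicitly).
* §3 THE WANTED VALUE-KEYED USE FORMS ⟹ 2ᶜᴰ (text inline): ★ `cornerDriftPos_of_anchoredNamed_drift` (THE PLANNER's WORDING), `cornerDriftPos_of_anchoredNamed_onVariety` (drift-variety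
  currency `lim = stepBal 2 F.L`), `cornerDriftPos_of_pin_drift` (pin `κ⋆ : ℕ → StepColourData` a PARAMETER — none chosen: (D1) at the pin + «the pin anchors every prefixed record»).
* §4 THE HONEST CONVERSE: `limPos_of_cornerDriftPos_of_namedAnchor` ∕ `limPosAtPin_of_cornerDriftPos_of_pinAnchors` — what 2ᶜᴰ hands BACK to the β ∕ D1 desks at a tuple anchored by
  named jets is the SIGN of the named limit, never its value; at tuples anchored by NO named datum 2ᶜᴰ is record-side (existence of SOME anchoring drifting `b`) and the named-jets
  currency is silent.

HONEST FRAMING.  NOTHING of Bałaban's analysis is asserted; NO limit is computed or SIGNED (`0 < CauchyRate.lim (beta0OfJs F κ)`, the anchor `ScaleAnchor …`, (D1) `OneLoopDrift (stepBal 2 F.L) …`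
are HYPOTHESES wherever they occur; instance 0∕1 each); (P6) — which κ is print's — NOT decided; (D1) NOT discharged at any colour datum; NO stub is proved (2ᶜᴰ at a tuple anchored by
no named datum, and 1ᶜᴿ, are record-side ∕ NODE O's wall); K2⁷ OPEN; counts UNMOVED (typed 28∕28 · discharged 5∕27 (A 5∕28)); [Balaban1987RG1] Thm 2 + (0.31) p. 259 (NODE O)
UNPROVED IN PRINT; route R4 closes the CONDITIONAL finite-𝕋⁴ rung `BalabanLadder.UV` only — NOT continuum, NOT ℝ⁴, NOT OS, NOT a mass gap; the Clay YM mass-gap problem is NOT proved by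
any of this; no summit statement is proved by this seat.  No `def`, no `instance`, no `notation`, no `axiom`, 0 `sorry`.  Sources (context only; nothing printed is used as a
hypothesis): [I] = [Balaban1987RG1] CMP **109** (1987): Thm 2 p. 259 (first sentence), (1.3) p. 260, (1.22) p. 264, Thm 3 p. 264, (2.12)–(2.14) p. 268, (5.10) p. 293.
-/

noncomputable section

namespace Summit.QuantumFields.YangMills.Theorems.BalabanUVNodesK2CornerDriftOfNamedJets

open Filter Topology
open Literature.MathematicalPhysics.QuantumFieldTheory.Balaban1983to89
open Literature.MathematicalPhysics.QuantumFieldTheory.Balaban1983to89.T4Continuum (T4Family)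
open Literature.MathematicalPhysics.QuantumFieldTheory.Balaban1983to89.Beta.Drift (OneLoopDrift)
open Literature.MathematicalPhysics.QuantumFieldTheory.Balaban1983to89.Beta.RateCertificate (CauchyRate)
open Literature.MathematicalPhysics.QuantumFieldTheory.Balaban1983to89.Beta.AveragingContoursRooted (ctrOff_mem_box)
open Summit.QuantumFields.BalabanUV.Beta.GAN24.WSlotT2TablesAn1 (allScalesSeq_secondMoment_JsBalAn1_pinned)
open Summit.QuantumFields.YangMills.Theorems.BalabanUVNodesK2JsOfRecord (StepColourData JsOfRecord beta0OfJs stepBal_L_pos)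
open Summit.QuantumFields.YangMills.Theorems.BalabanUVNodesK2NamedJetsRemAt (ScaleAnchor)
open Summit.QuantumFields.YangMills.Theorems.BalabanUVNodesK2V6Defs (Window13)
open Summit.QuantumFields.YangMills.Theorems.EndpointGivenBR13SepCoPH.Negative.RemNamedJets13FalseOfTwoNormalisations (oneLoopDrift_const_mul)
open Summit.QuantumFields.YangMills.Theorems.BalabanUVNodesK2NamedJetsLimit (two_le_L drift_iff_lim_eq)

/-! ## §1 Slope uniqueness for the named numbers (any real slope; any non-zero scale) -/

section Slope

variable (F : T4Family) (κ : StepColourData)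

/-- PRIVATE TWIN (public name: seat `ym-nodeO-d1-w1`'s `…K2CornerDriftOfAnchorSign.drift_beta0OfJs_at_lim`, CLAIM-2; carried privately here only until that module is built, as that
seat's p610944 carried a private twin of this lineage's `lim_beta0OfJs_normalForm`): the named numbers drift at their own limit, hypothesis-free (gan24-p1's all-scales rate +
`CauchyRate.geomRate` + `GeomRate.drift`). [folklore] -/
private theorem exists_drift_at_lim : ∃ A : ℝ, OneLoopDrift (CauchyRate.lim (beta0OfJs F κ)) A (beta0OfJs F κ) := by
  haveI : NeZero F.L := ⟨by have := F.hL.2; omega⟩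
  obtain ⟨c, θ, hθ0, hθ1, hall⟩ := allScalesSeq_secondMoment_JsBalAn1_pinned (two_le_L F) (ctrOff_mem_box F.hL.2.le) κ.cE κ.cVH κ.cΛ κ.cB κ.Tc 0 1
  exact ⟨_, (hall.cauchyRate.geomRate hθ1).drift hθ0 hθ1⟩

/-- **A DRIFT OF THE NAMED NUMBERS AT SLOPE `s` FORCES `CauchyRate.lim (beta0OfJs F κ) = s`, FOR ANY REAL SLOPE** (`CauchyRate.lim_eq_of_drift` on gan24-p1's hypothesis-free all-scales rate
of the pinned literal; Cesàro).  d1-w1's `drift_iff_lim_eq` (→) is the case `s := stepBal N F.L`.  No limit is computed. [folklore] -/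
theorem lim_eq_of_drift_slope {s A : ℝ} (h : OneLoopDrift s A (beta0OfJs F κ)) : CauchyRate.lim (beta0OfJs F κ) = s := by
  haveI : NeZero F.L := ⟨by have := F.hL.2; omega⟩
  obtain ⟨c, θ, -, hθ1, hall⟩ := allScalesSeq_secondMoment_JsBalAn1_pinned (two_le_L F) (ctrOff_mem_box F.hL.2.le) κ.cE κ.cVH κ.cΛ κ.cB κ.Tc 0 1
  exact hall.cauchyRate.lim_eq_of_drift hθ1 h

/-- **A DRIFT OF A NON-ZERO MULTIPLE `c • beta0OfJs F κ` AT SLOPE `s` FORCES `s = c · CauchyRate.lim (beta0OfJs F κ)`** (rescale by `c⁻¹`, `oneLoopDrift_const_mul`, then slope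
uniqueness).  The stub texts put `c := θ.cβ`. [folklore] -/
theorem slope_eq_of_drift_smul {c s A : ℝ} (hc : c ≠ 0) (h : OneLoopDrift s A (fun k => c * beta0OfJs F κ k)) : s = c * CauchyRate.lim (beta0OfJs F κ) := by
  have h' := oneLoopDrift_const_mul h c⁻¹
  have e : (fun j => c⁻¹ * (c * beta0OfJs F κ j)) = beta0OfJs F κ := by
    funext j
    rw [← mul_assoc, inv_mul_cancel₀ hc, one_mul]
  rw [e] at h'
  rw [lim_eq_of_drift_slope F κ h', ← mul_assoc, mul_inv_cancel₀ hc, one_mul]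

/-- **A POSITIVE MULTIPLE `c • beta0OfJs F κ` (`0 < c`) HAS A POSITIVE DRIFT ⟺ `0 < CauchyRate.lim (beta0OfJs F κ)`** (→ slope uniqueness; ← the drift at the limit rescaled by `c`,
slope `c · lim`, defect `|c| · A`).  The SIGN of the limit is a HYPOTHESIS wherever it occurs below. [folklore] -/
theorem exists_posDrift_smul_iff_lim_pos {c : ℝ} (hc : 0 < c) :
    (∃ s A : ℝ, 0 < s ∧ OneLoopDrift s A (fun k => c * beta0OfJs F κ k)) ↔ 0 < CauchyRate.lim (beta0OfJs F κ) := by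
  refine ⟨fun ⟨s, A, hs, hd⟩ => ?_, fun h => ?_⟩
  · have := slope_eq_of_drift_smul F κ hc.ne' hd
    rw [this] at hs
    exact pos_of_mul_pos_right hs hc.le
  · obtain ⟨A, hA⟩ := exists_drift_at_lim F κ
    exact ⟨c * CauchyRate.lim (beta0OfJs F κ), |c| * A, mul_pos hc h, oneLoopDrift_const_mul hA c⟩

end Slope

/-! ## §2 At a tuple ANCHORED by named jets, 2ᶜᴰ's body is the SIGN of one real number -/

section AnchoredTuple

variable {F : T4Family} {κ : StepColourData} {θ : Node00.Stage13HParams F 2} {hP : θ.Provisos₁₃SepCoPH F 2}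

/-- **THE ANCHORED CORNER DATA ARE THE NAMED ONES**: at an ADMISSIBLE tuple (`0 < θ.cβ`, Stage-9 chart clause) whose record's β is anchored scale by scale by the scaled named numbers
`θ.cβ • beta0OfJs F κ`, ANY anchoring sequence `b` drifting at slope `s` IS that scaled sequence (anchor uniqueness `ScaleAnchor.eq`) and `s = θ.cβ · CauchyRate.lim (beta0OfJs F κ)`
(§1). [folklore] -/
theorem eq_of_namedAnchor_cornerDrift (hθ : θ.Admissible F 2)
    (hN : ScaleAnchor (Node00.datumOfRecord₁₃SepCoPH F 2 θ hP).βfun (fun k => θ.cβ * beta0OfJs F κ k))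
    {b : ℕ → ℝ} {s A : ℝ} (hb : ScaleAnchor (Node00.datumOfRecord₁₃SepCoPH F 2 θ hP).βfun b) (hd : OneLoopDrift s A b) :
    b = (fun k => θ.cβ * beta0OfJs F κ k) ∧ s = θ.cβ * CauchyRate.lim (beta0OfJs F κ) := by
  have hbκ : b = fun k => θ.cβ * beta0OfJs F κ k := hb.eq hN
  refine ⟨hbκ, ?_⟩
  rw [hbκ] at hd
  exact slope_eq_of_drift_smul F κ (ne_of_gt hθ.toStage9.chart.1) hd

/-- **★★ AT A TUPLE ANCHORED BY NAMED JETS, 2ᶜᴰ's BODY ⟺ THE SIGN OF ONE REAL NUMBER**: for an admissible tuple whose record is anchored by `θ.cβ • beta0OfJs F κ`,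
`(∃ b s A, ScaleAnchor D.βfun b ∧ 0 < s ∧ OneLoopDrift s A b) ⟺ 0 < CauchyRate.lim (beta0OfJs F κ)`.  So the named-jets desks' EXACT share of v7's corner-drift stub, wherever their
jets anchor the record, is the SIGN of the one-loop limit at the anchoring datum — not (D1)'s VALUE `lim = stepBal 2 F.L` (which fixes the slope to Bałaban's, §3).  The (←) half is
seat d1-w1's SIGN road (CLAIM-2 `cornerDriftText_of_anchorPositiveK`) read at one tuple; the (→) half is §1's slope uniqueness + anchor uniqueness.  Which κ anchor which records is
record-side; no sign is certified here. [cite: Balaban1987RG1, (1.3) p.260 and (2.12)–(2.14) p.268] -/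
theorem cornerDriftAt_iff_limPos_of_namedAnchor (hθ : θ.Admissible F 2)
    (hN : ScaleAnchor (Node00.datumOfRecord₁₃SepCoPH F 2 θ hP).βfun (fun k => θ.cβ * beta0OfJs F κ k)) :
    (∃ (b : ℕ → ℝ) (s A : ℝ), ScaleAnchor (Node00.datumOfRecord₁₃SepCoPH F 2 θ hP).βfun b ∧ 0 < s ∧ OneLoopDrift s A b) ↔
      0 < CauchyRate.lim (beta0OfJs F κ) := by
  have hcβ : 0 < θ.cβ := hθ.toStage9.chart.1
  refine ⟨fun ⟨b, s, A, hb, hs, hd⟩ => ?_, fun h => ?_⟩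
  · have := (eq_of_namedAnchor_cornerDrift hθ hN hb hd).2
    rw [this] at hs
    exact pos_of_mul_pos_right hs hcβ.le
  · obtain ⟨s, A, hs, hd⟩ := (exists_posDrift_smul_iff_lim_pos F κ hcβ).mpr h
    exact ⟨_, s, A, hN, hs, hd⟩

/-- **(D1) AT PRINT's TABLE FOR THE ANCHORING DATUM ⟹ 2ᶜᴰ's BODY WITH BAŁABAN's SCALED SLOPE EXPLICITLY**: anchor by `θ.cβ • beta0OfJs F κ` + `OneLoopDrift (stepBal 2 F.L) A (beta0OfJs F κ)`
⟹ `∃ b s A, …` with `b := θ.cβ • beta0OfJs F κ`, `s := θ.cβ · stepBal 2 F.L > 0` (admissibility and `1 < F.L`), defect `|θ.cβ| · A` (`oneLoopDrift_const_mul θ.cβ`).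
[cite: Balaban1987RG1, (1.3) p.260 and (2.12)–(2.14) p.268] -/
theorem cornerDriftAt_of_namedAnchor_drift (hθ : θ.Admissible F 2)
    (hN : ScaleAnchor (Node00.datumOfRecord₁₃SepCoPH F 2 θ hP).βfun (fun k => θ.cβ * beta0OfJs F κ k))
    {A : ℝ} (hD1 : OneLoopDrift (B12Normalization.stepBal 2 F.L) A (beta0OfJs F κ)) :
    ∃ (b : ℕ → ℝ) (s A : ℝ), ScaleAnchor (Node00.datumOfRecord₁₃SepCoPH F 2 θ hP).βfun b ∧ 0 < s ∧ OneLoopDrift s A b :=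
  ⟨_, θ.cβ * B12Normalization.stepBal 2 F.L, |θ.cβ| * A, hN, mul_pos hθ.toStage9.chart.1 (stepBal_L_pos F two_pos), oneLoopDrift_const_mul hD1 θ.cβ⟩

end AnchoredTuple

/-! ## §3 The WANTED value-keyed use forms ⟹ the registered 2ᶜᴰ text `CornerDriftPos` (v7 corner re-key; text INLINE, verbatim over the tree letters) -/

section UseForms

/-- **★ THE PLANNER's WORDING — ANCHOR + (D1) AT PRINT's TABLE ⟹ 2ᶜᴰ**: if at every tuple carrying the crux's prefix SOME colour datum's scaled named numbers anchor the record AND row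
(D1) holds at print's table for that datum (`∃ A, OneLoopDrift (stepBal 2 F.L) A (beta0OfJs F κ)`), then 2ᶜᴰ (`CornerDriftPos`, inline) with `b := θ.cβ • beta0OfJs F κ`,
`s := θ.cβ · stepBal 2 F.L > 0` (∃-intro, `oneLoopDrift_const_mul`).  CONDITIONAL on both displayed hypotheses — the identification (record-side) and the β-row binder at that datum
(β sub-cell) — neither asserted; nothing of Bałaban asserted. [cite: Balaban1987RG1, (1.3) p.260, (2.12)–(2.14) p.268 and Thm 3 p.264] -/
theorem cornerDriftPos_of_anchoredNamed_drift
    (h : ∀ (F : T4Family) (θ : Node00.Stage13HParams F 2) (hP : θ.Provisos₁₃SepCoPH F 2), (θ.ZhUnity F 2 ∧ θ.SlotsNondegenerate₁₃ F 2) → θ.Admissible F 2 →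
      B16.EndStatementBPrinted (Node00.datumOfRecord₁₃SepCoPH F 2 θ hP).C → Window13 F θ hP →
      ∃ κ : StepColourData, ScaleAnchor (Node00.datumOfRecord₁₃SepCoPH F 2 θ hP).βfun (fun k => θ.cβ * beta0OfJs F κ k) ∧
        ∃ A : ℝ, OneLoopDrift (B12Normalization.stepBal 2 F.L) A (beta0OfJs F κ)) :
    ∀ (F : T4Family) (θ : Node00.Stage13HParams F 2) (hP : θ.Provisos₁₃SepCoPH F 2), (θ.ZhUnity F 2 ∧ θ.SlotsNondegenerate₁₃ F 2) → θ.Admissible F 2 →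
      B16.EndStatementBPrinted (Node00.datumOfRecord₁₃SepCoPH F 2 θ hP).C → Window13 F θ hP →
      ∃ (b : ℕ → ℝ) (s A : ℝ), ScaleAnchor (Node00.datumOfRecord₁₃SepCoPH F 2 θ hP).βfun b ∧ 0 < s ∧ OneLoopDrift s A b := by
  intro F θ hP hU hθ hB hwin
  obtain ⟨κ, hN, A, hD1⟩ := h F θ hP hU hθ hB hwin
  exact cornerDriftAt_of_namedAnchor_drift hθ hN hD1

/-- … the same in the drift-VARIETY currency of the named-jets files: anchor at a datum ON THE VARIETY `CauchyRate.lim (beta0OfJs F κ) = stepBal 2 F.L` ⟹ 2ᶜᴰ (d1-w1's `drift_iff_lim_eq`).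
[folklore] -/
theorem cornerDriftPos_of_anchoredNamed_onVariety
    (h : ∀ (F : T4Family) (θ : Node00.Stage13HParams F 2) (hP : θ.Provisos₁₃SepCoPH F 2), (θ.ZhUnity F 2 ∧ θ.SlotsNondegenerate₁₃ F 2) → θ.Admissible F 2 →
      B16.EndStatementBPrinted (Node00.datumOfRecord₁₃SepCoPH F 2 θ hP).C → Window13 F θ hP →
      ∃ κ : StepColourData, ScaleAnchor (Node00.datumOfRecord₁₃SepCoPH F 2 θ hP).βfun (fun k => θ.cβ * beta0OfJs F κ k) ∧
        CauchyRate.lim (beta0OfJs F κ) = B12Normalization.stepBal 2 F.L) :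
    ∀ (F : T4Family) (θ : Node00.Stage13HParams F 2) (hP : θ.Provisos₁₃SepCoPH F 2), (θ.ZhUnity F 2 ∧ θ.SlotsNondegenerate₁₃ F 2) → θ.Admissible F 2 →
      B16.EndStatementBPrinted (Node00.datumOfRecord₁₃SepCoPH F 2 θ hP).C → Window13 F θ hP →
      ∃ (b : ℕ → ℝ) (s A : ℝ), ScaleAnchor (Node00.datumOfRecord₁₃SepCoPH F 2 θ hP).βfun b ∧ 0 < s ∧ OneLoopDrift s A b :=
  cornerDriftPos_of_anchoredNamed_drift fun F θ hP hU hθ hB hwin => by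
    obtain ⟨κ, hN, hlim⟩ := h F θ hP hU hθ hB hwin
    exact ⟨κ, hN, (drift_iff_lim_eq F κ 2).mpr hlim⟩

/-- **PINNED EDITION — (D1) AT THE PIN + «THE PIN ANCHORS EVERY PREFIXED RECORD» ⟹ 2ᶜᴰ** (pin `κ⋆ : ℕ → StepColourData` a PARAMETER — the (P6) datum, NOT decided anywhere in the tree;
the two hypotheses are CRIT-2 ROUND 4's re-deal (b) texts — the θ-free β-row binder at one member (`K2V6Defs.…_of_pin`'s `hD1`) and the identification at the pin). [folklore] -/
theorem cornerDriftPos_of_pin_drift (κ : ℕ → StepColourData)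
    (hD1 : ∀ F : T4Family, ∃ A : ℝ, OneLoopDrift (B12Normalization.stepBal 2 F.L) A (beta0OfJs F (κ F.L)))
    (hN : ∀ (F : T4Family) (θ : Node00.Stage13HParams F 2) (hP : θ.Provisos₁₃SepCoPH F 2), (θ.ZhUnity F 2 ∧ θ.SlotsNondegenerate₁₃ F 2) → θ.Admissible F 2 →
      B16.EndStatementBPrinted (Node00.datumOfRecord₁₃SepCoPH F 2 θ hP).C → Window13 F θ hP →
      ScaleAnchor (Node00.datumOfRecord₁₃SepCoPH F 2 θ hP).βfun (fun k => θ.cβ * beta0OfJs F (κ F.L) k)) :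
    ∀ (F : T4Family) (θ : Node00.Stage13HParams F 2) (hP : θ.Provisos₁₃SepCoPH F 2), (θ.ZhUnity F 2 ∧ θ.SlotsNondegenerate₁₃ F 2) → θ.Admissible F 2 →
      B16.EndStatementBPrinted (Node00.datumOfRecord₁₃SepCoPH F 2 θ hP).C → Window13 F θ hP →
      ∃ (b : ℕ → ℝ) (s A : ℝ), ScaleAnchor (Node00.datumOfRecord₁₃SepCoPH F 2 θ hP).βfun b ∧ 0 < s ∧ OneLoopDrift s A b :=
  cornerDriftPos_of_anchoredNamed_drift fun F θ hP hU hθ hB hwin => ⟨κ F.L, hN F θ hP hU hθ hB hwin, hD1 F⟩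

end UseForms

/-! ## §4 The honest converse: what 2ᶜᴰ hands back to the named-jets desks -/

section Converse

/-- **★ 2ᶜᴰ AT A TUPLE ANCHORED BY NAMED JETS GIVES BACK THE SIGN OF THE NAMED LIMIT — and nothing more**: if 2ᶜᴰ holds (inline text) then at every tuple carrying the crux's prefix
whose record is anchored by `θ.cβ • beta0OfJs F κ`, `0 < CauchyRate.lim (beta0OfJs F κ)` (§2).  At tuples anchored by NO named datum 2ᶜᴰ is a statement about the record's corner
sequence alone (record-side) and the named-jets currency is silent. [folklore] -/
theorem limPos_of_cornerDriftPos_of_namedAnchor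
    (h2 : ∀ (F : T4Family) (θ : Node00.Stage13HParams F 2) (hP : θ.Provisos₁₃SepCoPH F 2), (θ.ZhUnity F 2 ∧ θ.SlotsNondegenerate₁₃ F 2) → θ.Admissible F 2 →
      B16.EndStatementBPrinted (Node00.datumOfRecord₁₃SepCoPH F 2 θ hP).C → Window13 F θ hP →
      ∃ (b : ℕ → ℝ) (s A : ℝ), ScaleAnchor (Node00.datumOfRecord₁₃SepCoPH F 2 θ hP).βfun b ∧ 0 < s ∧ OneLoopDrift s A b)
    (F : T4Family) (θ : Node00.Stage13HParams F 2) (hP : θ.Provisos₁₃SepCoPH F 2) (hU : θ.ZhUnity F 2 ∧ θ.SlotsNondegenerate₁₃ F 2) (hθ : θ.Admissible F 2)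
    (hB : B16.EndStatementBPrinted (Node00.datumOfRecord₁₃SepCoPH F 2 θ hP).C) (hwin : Window13 F θ hP)
    (κ : StepColourData) (hN : ScaleAnchor (Node00.datumOfRecord₁₃SepCoPH F 2 θ hP).βfun (fun k => θ.cβ * beta0OfJs F κ k)) :
    0 < CauchyRate.lim (beta0OfJs F κ) :=
  (cornerDriftAt_iff_limPos_of_namedAnchor hθ hN).mp (h2 F θ hP hU hθ hB hwin)

/-- … in particular 2ᶜᴰ together with «the pin `κ⋆` anchors every prefixed record» gives `0 < CauchyRate.lim (beta0OfJs F (κ⋆ F.L))` at every family CARRYING A PREFIXED TUPLE — the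
SIGN at the pin, relative to the inhabitation of K2⁷'s surface (never a value, never unconditionally). [folklore] -/
theorem limPosAtPin_of_cornerDriftPos_of_pinAnchors (κ : ℕ → StepColourData)
    (h2 : ∀ (F : T4Family) (θ : Node00.Stage13HParams F 2) (hP : θ.Provisos₁₃SepCoPH F 2), (θ.ZhUnity F 2 ∧ θ.SlotsNondegenerate₁₃ F 2) → θ.Admissible F 2 →
      B16.EndStatementBPrinted (Node00.datumOfRecord₁₃SepCoPH F 2 θ hP).C → Window13 F θ hP →
      ∃ (b : ℕ → ℝ) (s A : ℝ), ScaleAnchor (Node00.datumOfRecord₁₃SepCoPH F 2 θ hP).βfun b ∧ 0 < s ∧ OneLoopDrift s A b)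
    (hN : ∀ (F : T4Family) (θ : Node00.Stage13HParams F 2) (hP : θ.Provisos₁₃SepCoPH F 2), (θ.ZhUnity F 2 ∧ θ.SlotsNondegenerate₁₃ F 2) → θ.Admissible F 2 →
      B16.EndStatementBPrinted (Node00.datumOfRecord₁₃SepCoPH F 2 θ hP).C → Window13 F θ hP →
      ScaleAnchor (Node00.datumOfRecord₁₃SepCoPH F 2 θ hP).βfun (fun k => θ.cβ * beta0OfJs F (κ F.L) k))
    (F : T4Family) (θ : Node00.Stage13HParams F 2) (hP : θ.Provisos₁₃SepCoPH F 2) (hU : θ.ZhUnity F 2 ∧ θ.SlotsNondegenerate₁₃ F 2) (hθ : θ.Admissible F 2)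
    (hB : B16.EndStatementBPrinted (Node00.datumOfRecord₁₃SepCoPH F 2 θ hP).C) (hwin : Window13 F θ hP) :
    0 < CauchyRate.lim (beta0OfJs F (κ F.L)) :=
  limPos_of_cornerDriftPos_of_namedAnchor h2 F θ hP hU hθ hB hwin (κ F.L) (hN F θ hP hU hθ hB hwin)

end Converse

end Summit.QuantumFields.YangMills.Theorems.BalabanUVNodesK2CornerDriftOfNamedJets

end
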